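import Summits.CriticalPhenomena.CardyFormulaZ2.Theorems.CardyWhiteToColouredNoiseDiscretisationCellIntegral

/-!
# The `L²` size of the coupling discrepancy

Helper file for item `NoiseDiscretisation` (stmt-CriticalPhenomena-4598) of route
`CardyWhiteToColoured` (`CardyFormulaZ2`). In the coupling, the smoothed lattice noise at `x`
(scaled by the normalising constant) minus the smoothed continuum noise at `x` is the limit of the
white noise evaluated at the test functions with values
`φ_s(y) = ∑_{e ∈ s} K(x − m_δ(e)) h_e(y) − K(y − x)` (`s` a finite set of edges, `h_e` the cell
bumps, `K = gaussWeight ℓ`), whose variances are `∫ φ_s²`. We bound these variances along an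
exhaustion `s_n ↑ E(ℤ²)`: for `0 < δ ≤ ℓ`, `0 < θ < 1` and every `ε > 0`, eventually
`∫ φ_{s_n}² ≤ 26 δ² + 120 θ ℓ² + ε` (`integral_sq_partial_le_eventually`).

Pointwise, with `S_s = ∑_{e ∈ s} h_e ∈ [0, 1]` (disjoint supports),
`φ_s = [∑ (K(x − m_e) − K(· − x)) h_e] − K(· − x)(1 − S_s)`; the first bracket is at most
`(δ/ℓ) exp(−‖· − x‖²/(8ℓ²))` by the Lipschitz-with-decay estimate of the kernel (each `h_e` lives
within `δ/2` of `m_e`), whose square integrates to `4π δ²`; the second has square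
`≤ K²(1 − S_s)²`, which decreases along the exhaustion to `K²(1 − S_∞)² ≤ K² 𝟙[off plateaus]`
(dominated convergence), of mass `≤ 60 θ ℓ²` (`lintegral_gaussWeight_sq_offPlateau_le`).

References: S. Muirhead, H. Vanneuville, Ann. Inst. H. Poincaré Probab. Stat. 56 (2020), §3.
-/

noncomputable section

namespace Summit.CriticalPhenomena.CardyFormulaZ2.Theorems

namespace WhiteToColoured

open Set Metric MeasureTheory Filter Topology Real ENNReal Finset
open scoped ContDiff
open Literature.Probability.LatticeModels Literature.Probability.Percolation

/-- `Dg[w] = max |Re w + Im w| |Re w − Im w| = |Re w| + |Im w|`, the rotated sup-distance. -/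
local notation3 "Dg[" w "]" => max |Complex.re w + Complex.im w| |Complex.re w - Complex.im w|

/-- The value `hB[β, m, z] = β (p (z − m)) · β (q (z − m))` of the cell bump built from a
one-dimensional bump `β` and centred at `m`. -/
local notation3 "hB[" β ", " m ", " z "]" =>
  (β : ℝ → ℝ) (Complex.re (z - m) + Complex.im (z - m)) * β (Complex.re (z - m) - Complex.im (z - m))

section

variable {β : ℝ → ℝ} {ℓ δ θ : ℝ}

/-! ### The sum of the cell bumps is at most one -/

/-- **Bumps of distinct edges have disjoint supports** (separation of the medial lattice). -/
theorem hB_medial_mul_eq_zero (hδ : 0 < δ) (hθ0 : 0 < θ)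
    (hβ0 : ∀ w, β w ≠ 0 → |w| < (1 - θ / 2) * δ / 2) {e e' : (zdGraph 2).edgeSet} (hne : e ≠ e')
    (y : ℂ) : hB[β, medialPoint δ e.1, y] * hB[β, medialPoint δ e'.1, y] = 0 := by
  refine hB_mul_hB_eq_zero hβ0 ?_ y
  have hsep := le_dg_medialPoint_sub hδ e.2 e'.2 fun h => hne (Subtype.ext h)
  nlinarith

/-- **The sum of the cell bumps over any finite set of edges lies in `[0, 1]`.** -/
theorem sum_hB_mem_Icc (hδ : 0 < δ) (hθ0 : 0 < θ)
    (hβ0 : ∀ w, β w ≠ 0 → |w| < (1 - θ / 2) * δ / 2) (hβp : ∀ w, 0 ≤ β w) (hβ1 : ∀ w, β w ≤ 1)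
    (s : Finset (zdGraph 2).edgeSet) (y : ℂ) :
    0 ≤ ∑ e ∈ s, hB[β, medialPoint δ e.1, y] ∧ ∑ e ∈ s, hB[β, medialPoint δ e.1, y] ≤ 1 := by
  set S := ∑ e ∈ s, hB[β, medialPoint δ e.1, y] with hS
  have h0 : 0 ≤ S := Finset.sum_nonneg fun e _ => hB_nonneg hβp _ _
  refine ⟨h0, ?_⟩
  -- `S² = ∑ h_e² ≤ ∑ h_e = S`
  have hsq : S * S ≤ S := by
    rw [hS, Finset.sum_mul_sum]
    calc ∑ e ∈ s, ∑ e' ∈ s, hB[β, medialPoint δ e.1, y] * hB[β, medialPoint δ e'.1, y]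
        = ∑ e ∈ s, hB[β, medialPoint δ e.1, y] * hB[β, medialPoint δ e.1, y] := by
          refine Finset.sum_congr rfl fun e he => ?_
          rw [Finset.sum_eq_single_of_mem e he]
          intro e' _ hne
          exact hB_medial_mul_eq_zero hδ hθ0 hβ0 (Ne.symm hne) y
      _ ≤ ∑ e ∈ s, hB[β, medialPoint δ e.1, y] := by
          refine Finset.sum_le_sum fun e _ => ?_
          have h1 := hB_le_one hβp hβ1 (medialPoint δ e.1) y
          have h2 := hB_nonneg hβp (medialPoint δ e.1) y
          nlinarith
  nlinarith

/-- The family of cell bumps at a point has at most one non-zero member, hence is summable. -/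
theorem summable_hB (hδ : 0 < δ) (hθ0 : 0 < θ) (hβ0 : ∀ w, β w ≠ 0 → |w| < (1 - θ / 2) * δ / 2)
    (y : ℂ) : Summable fun e : (zdGraph 2).edgeSet => hB[β, medialPoint δ e.1, y] := by
  refine summable_of_hasFiniteSupport (Set.Subsingleton.finite ?_)
  intro e he e' he'
  by_contra hne
  have := hB_medial_mul_eq_zero hδ hθ0 hβ0 hne y
  exact (mul_ne_zero (Function.mem_support.1 he) (Function.mem_support.1 he')) this

/-- **The total sum of the cell bumps lies in `[0, 1]` and is `1` on the plateaus.** -/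
theorem tsum_hB_le_one (hδ : 0 < δ) (hθ0 : 0 < θ)
    (hβ0 : ∀ w, β w ≠ 0 → |w| < (1 - θ / 2) * δ / 2) (hβp : ∀ w, 0 ≤ β w) (hβ1 : ∀ w, β w ≤ 1)
    (y : ℂ) : 0 ≤ ∑' e : (zdGraph 2).edgeSet, hB[β, medialPoint δ e.1, y] ∧
      ∑' e : (zdGraph 2).edgeSet, hB[β, medialPoint δ e.1, y] ≤ 1 :=
  ⟨tsum_nonneg fun _ => hB_nonneg hβp _ _,
    (summable_hB hδ hθ0 hβ0 y).tsum_le_of_sum_le fun s => (sum_hB_mem_Icc hδ hθ0 hβ0 hβp hβ1 s y).2⟩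

/-- On the plateau of a cell the total sum of the cell bumps equals `1`. -/
theorem tsum_hB_eq_one_of_plateau (hδ : 0 < δ) (hθ0 : 0 < θ)
    (hβ1' : ∀ w, |w| ≤ (1 - θ) * δ / 2 → β w = 1)
    (hβ0 : ∀ w, β w ≠ 0 → |w| < (1 - θ / 2) * δ / 2) (hβp : ∀ w, 0 ≤ β w) (hβ1 : ∀ w, β w ≤ 1)
    {y : ℂ} {e₀ : (zdGraph 2).edgeSet} (hy : Dg[y - medialPoint δ e₀.1] ≤ (1 - θ) * δ / 2) :
    ∑' e : (zdGraph 2).edgeSet, hB[β, medialPoint δ e.1, y] = 1 := by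
  refine le_antisymm (tsum_hB_le_one hδ hθ0 hβ0 hβp hβ1 y).2 ?_
  have h1 : hB[β, medialPoint δ e₀.1, y] = 1 := hB_eq_one hβ1' hy
  rw [← h1]
  exact (summable_hB hδ hθ0 hβ0 y).le_tsum e₀ fun e _ => hB_nonneg hβp _ _

/-! ### Pointwise bound of the partial sums -/

/-- **Pointwise bound.** With `S_s = ∑_{e∈s} h_e`,
`(∑_{e∈s} K(x − m_e) h_e(y) − K(y − x))² ≤ 2 (δ/ℓ)² exp(−‖y − x‖²/(4ℓ²)) + 2 K(y − x)² (1 − S_s(y))²`. -/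
theorem sq_partial_le (hℓ : 0 < ℓ) (hδ : 0 < δ) (hδℓ : δ ≤ ℓ) (hθ0 : 0 < θ)
    (hβ0 : ∀ w, β w ≠ 0 → |w| < (1 - θ / 2) * δ / 2) (hβp : ∀ w, 0 ≤ β w) (hβ1 : ∀ w, β w ≤ 1)
    (s : Finset (zdGraph 2).edgeSet) (x y : ℂ) :
    (∑ e ∈ s, gaussWeight ℓ (x - medialPoint δ e.1) * hB[β, medialPoint δ e.1, y] -
        gaussWeight ℓ (y - x)) ^ 2 ≤
      2 * ((δ / ℓ) ^ 2 * Real.exp (-‖y - x‖ ^ 2 / (4 * ℓ ^ 2))) +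
        2 * (gaussWeight ℓ (y - x) ^ 2 * (1 - ∑ e ∈ s, hB[β, medialPoint δ e.1, y]) ^ 2) := by
  set S := ∑ e ∈ s, hB[β, medialPoint δ e.1, y] with hS
  obtain ⟨hS0, hS1⟩ := sum_hB_mem_Icc hδ hθ0 hβ0 hβp hβ1 s y
  set G := Real.exp (-‖y - x‖ ^ 2 / (8 * ℓ ^ 2)) with hG
  -- the Lipschitz part
  have hA : |∑ e ∈ s, gaussWeight ℓ (x - medialPoint δ e.1) * hB[β, medialPoint δ e.1, y] -
      gaussWeight ℓ (y - x) * S| ≤ δ / ℓ * G := by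
    rw [hS, Finset.mul_sum, ← Finset.sum_sub_distrib]
    refine (Finset.abs_sum_le_sum_abs _ _).trans ?_
    calc ∑ e ∈ s, |gaussWeight ℓ (x - medialPoint δ e.1) * hB[β, medialPoint δ e.1, y] -
            gaussWeight ℓ (y - x) * hB[β, medialPoint δ e.1, y]|
        ≤ ∑ e ∈ s, δ / ℓ * G * hB[β, medialPoint δ e.1, y] := by
          refine Finset.sum_le_sum fun e _ => ?_
          rw [← sub_mul, abs_mul, abs_of_nonneg (hB_nonneg hβp _ _)]
          by_cases hh : hB[β, medialPoint δ e.1, y] = 0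
          · simp only [hh, mul_zero, le_refl]
          · refine mul_le_mul_of_nonneg_right ?_ (hB_nonneg hβp _ _)
            have hym : ‖y - medialPoint δ e.1‖ ≤ δ / 2 := by
              have := dg_lt_of_hB_ne_zero hβ0 hh
              refine (norm_le_dg _).trans ?_
              nlinarith
            rw [gaussWeight_sub_comm ℓ x]
            exact abs_gaussWeight_sub_le hℓ hδ hδℓ hym
      _ = δ / ℓ * G * S := by rw [hS, Finset.mul_sum]
      _ ≤ δ / ℓ * G * 1 := by gcongr
      _ = δ / ℓ * G := mul_one _
  -- decomposition and `(a - b)² ≤ 2a² + 2b²`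
  have hdecomp : ∑ e ∈ s, gaussWeight ℓ (x - medialPoint δ e.1) * hB[β, medialPoint δ e.1, y] -
      gaussWeight ℓ (y - x) =
      (∑ e ∈ s, gaussWeight ℓ (x - medialPoint δ e.1) * hB[β, medialPoint δ e.1, y] -
        gaussWeight ℓ (y - x) * S) - gaussWeight ℓ (y - x) * (1 - S) := by ring
  rw [hdecomp]
  have hG2 : G ^ 2 = Real.exp (-‖y - x‖ ^ 2 / (4 * ℓ ^ 2)) := by
    rw [hG, ← Real.exp_nat_mul]; congr 1; push_cast; ring
  have hAsq := sq_le_sq' (abs_le.1 hA).1 (abs_le.1 hA).2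
  rw [mul_pow, hG2] at hAsq
  nlinarith [sq_nonneg ((∑ e ∈ s, gaussWeight ℓ (x - medialPoint δ e.1) * hB[β, medialPoint δ e.1, y] -
      gaussWeight ℓ (y - x) * S) + gaussWeight ℓ (y - x) * (1 - S)),
    mul_pow (gaussWeight ℓ (y - x)) (1 - S) 2]

/-! ### Integrated bound -/

/-- Continuity of the Gaussian kernel. -/
theorem continuous_gaussWeight (ℓ : ℝ) : Continuous (gaussWeight ℓ) := by
  unfold gaussWeight; fun_prop

/-- Continuity of `y ↦ K(y − x)²`. -/
theorem continuous_gaussWeight_sub_sq (ℓ : ℝ) (x : ℂ) :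
    Continuous fun y : ℂ => gaussWeight ℓ (y - x) ^ 2 :=
  ((continuous_gaussWeight ℓ).comp (continuous_id.sub continuous_const)).pow 2

/-- Continuity of the cell-bump sums. -/
theorem continuous_sum_hB (hβ : ContDiff ℝ ∞ β) (s : Finset (zdGraph 2).edgeSet) :
    Continuous fun y : ℂ => ∑ e ∈ s, hB[β, medialPoint δ e.1, y] :=
  continuous_finsetSum s fun _ _ => hB_continuous hβ _

/-- **Integrated bound for a finite set of edges**:
`∫ φ_s² ≤ 26 δ² + 2 ∫ K(y − x)² (1 − S_s(y))² dy`. -/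
theorem integral_sq_partial_le (hℓ : 0 < ℓ) (hδ : 0 < δ) (hδℓ : δ ≤ ℓ) (hθ0 : 0 < θ)
    (hβ : ContDiff ℝ ∞ β) (hβ0 : ∀ w, β w ≠ 0 → |w| < (1 - θ / 2) * δ / 2) (hβp : ∀ w, 0 ≤ β w)
    (hβ1 : ∀ w, β w ≤ 1) (s : Finset (zdGraph 2).edgeSet) (x : ℂ) :
    ∫ y, (∑ e ∈ s, gaussWeight ℓ (x - medialPoint δ e.1) * hB[β, medialPoint δ e.1, y] -
        gaussWeight ℓ (y - x)) ^ 2 ≤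
      26 * δ ^ 2 + 2 * ∫ y, gaussWeight ℓ (y - x) ^ 2 *
        (1 - ∑ e ∈ s, hB[β, medialPoint δ e.1, y]) ^ 2 := by
  have hG : Integrable fun y : ℂ => (δ / ℓ) ^ 2 * Real.exp (-‖y - x‖ ^ 2 / (4 * ℓ ^ 2)) :=
    (integrable_exp_neg_sq_norm_sub_div (by positivity) x).const_mul _
  have hK2 : Integrable fun y : ℂ => gaussWeight ℓ (y - x) ^ 2 := by
    have := integrable_exp_neg_sq_norm_sub_div (c := ℓ ^ 2) (by positivity) x
    refine this.congr (Eventually.of_forall fun y => ?_)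
    simp only [gaussWeight_sq]
  have hT : Integrable fun y : ℂ => gaussWeight ℓ (y - x) ^ 2 *
      (1 - ∑ e ∈ s, hB[β, medialPoint δ e.1, y]) ^ 2 := by
    refine hK2.mono ?_ (Eventually.of_forall fun y => ?_)
    · exact ((continuous_gaussWeight_sub_sq ℓ x).mul
        ((continuous_const.sub (continuous_sum_hB hβ s)).pow 2)).aestronglyMeasurable
    · obtain ⟨h0, h1⟩ := sum_hB_mem_Icc hδ hθ0 hβ0 hβp hβ1 s y
      have hle : gaussWeight ℓ (y - x) ^ 2 * (1 - ∑ e ∈ s, hB[β, medialPoint δ e.1, y]) ^ 2 ≤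
          gaussWeight ℓ (y - x) ^ 2 := by
        have : (1 - ∑ e ∈ s, hB[β, medialPoint δ e.1, y]) ^ 2 ≤ 1 := by nlinarith
        nlinarith [sq_nonneg (gaussWeight ℓ (y - x))]
      rw [Real.norm_of_nonneg (by positivity), Real.norm_of_nonneg (by positivity)]
      exact hle
  calc ∫ y, (∑ e ∈ s, gaussWeight ℓ (x - medialPoint δ e.1) * hB[β, medialPoint δ e.1, y] -
          gaussWeight ℓ (y - x)) ^ 2
      ≤ ∫ y, 2 * ((δ / ℓ) ^ 2 * Real.exp (-‖y - x‖ ^ 2 / (4 * ℓ ^ 2))) +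
          2 * (gaussWeight ℓ (y - x) ^ 2 * (1 - ∑ e ∈ s, hB[β, medialPoint δ e.1, y]) ^ 2) := by
        refine integral_mono_of_nonneg (Eventually.of_forall fun y => sq_nonneg _)
          ((hG.const_mul 2).add (hT.const_mul 2)) (Eventually.of_forall fun y => ?_)
        exact sq_partial_le hℓ hδ hδℓ hθ0 hβ0 hβp hβ1 s x y
    _ = 2 * ((δ / ℓ) ^ 2 * (π * (4 * ℓ ^ 2))) + 2 * ∫ y, gaussWeight ℓ (y - x) ^ 2 *
          (1 - ∑ e ∈ s, hB[β, medialPoint δ e.1, y]) ^ 2 := by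
        rw [integral_add (hG.const_mul 2) (hT.const_mul 2), integral_const_mul, integral_const_mul,
          integral_const_mul, integral_exp_neg_sq_norm_sub_div (by positivity) x]
    _ ≤ 26 * δ ^ 2 + 2 * ∫ y, gaussWeight ℓ (y - x) ^ 2 *
          (1 - ∑ e ∈ s, hB[β, medialPoint δ e.1, y]) ^ 2 := by
        have hπ : π < 3.1416 := Real.pi_lt_d4
        have : 2 * ((δ / ℓ) ^ 2 * (π * (4 * ℓ ^ 2))) = 8 * π * δ ^ 2 := by
          field_simp; ring
        rw [this]
        nlinarith [sq_nonneg δ]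

/-! ### Along an exhaustion: dominated convergence of the margin term -/

/-- **The margin term along an exhaustion** tends to `∫ K(y − x)² (1 − S_∞(y))² dy`. -/
theorem tendsto_integral_margin (hℓ : 0 < ℓ) (hδ : 0 < δ) (hθ0 : 0 < θ)
    (hβ : ContDiff ℝ ∞ β) (hβ0 : ∀ w, β w ≠ 0 → |w| < (1 - θ / 2) * δ / 2) (hβp : ∀ w, 0 ≤ β w)
    (hβ1 : ∀ w, β w ≤ 1) (x : ℂ) {s : ℕ → Finset (zdGraph 2).edgeSet} (hmono : Monotone s)
    (hex : ∀ e, ∃ n, e ∈ s n) :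
    Tendsto (fun n => ∫ y, gaussWeight ℓ (y - x) ^ 2 * (1 - ∑ e ∈ s n, hB[β, medialPoint δ e.1, y]) ^ 2)
      atTop (𝓝 (∫ y, gaussWeight ℓ (y - x) ^ 2 *
        (1 - ∑' e : (zdGraph 2).edgeSet, hB[β, medialPoint δ e.1, y]) ^ 2)) := by
  have hs : Tendsto s atTop atTop := tendsto_atTop_finset_of_monotone hmono hex
  have hK2 : Integrable fun y : ℂ => gaussWeight ℓ (y - x) ^ 2 := by
    have := integrable_exp_neg_sq_norm_sub_div (c := ℓ ^ 2) (by positivity) x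
    refine this.congr (Eventually.of_forall fun y => ?_)
    simp only [gaussWeight_sq]
  refine tendsto_integral_of_dominated_convergence (fun y => gaussWeight ℓ (y - x) ^ 2)
    (fun n => ?_) hK2 (fun n => Eventually.of_forall fun y => ?_) (Eventually.of_forall fun y => ?_)
  · exact ((continuous_gaussWeight_sub_sq ℓ x).mul
      ((continuous_const.sub (continuous_sum_hB hβ (s n))).pow 2)).aestronglyMeasurable
  · obtain ⟨h0, h1⟩ := sum_hB_mem_Icc hδ hθ0 hβ0 hβp hβ1 (s n) y
    have hle : gaussWeight ℓ (y - x) ^ 2 * (1 - ∑ e ∈ s n, hB[β, medialPoint δ e.1, y]) ^ 2 ≤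
        gaussWeight ℓ (y - x) ^ 2 := by
      have : (1 - ∑ e ∈ s n, hB[β, medialPoint δ e.1, y]) ^ 2 ≤ 1 := by nlinarith
      nlinarith [sq_nonneg (gaussWeight ℓ (y - x))]
    rw [Real.norm_of_nonneg (by positivity)]
    exact hle
  · have hsum := (summable_hB hδ hθ0 hβ0 y).hasSum.comp hs
    exact ((continuous_const.sub continuous_id).pow 2 |>.tendsto _ |>.comp hsum).const_mul _

/-- **The limit margin term is at most the Gaussian mass of the margins**:
`∫ K(y − x)² (1 − S_∞(y))² dy ≤ 60 θ ℓ²`. -/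
theorem integral_margin_limit_le (hℓ : 0 < ℓ) (hδ : 0 < δ) (hδℓ : δ ≤ ℓ) (hθ0 : 0 < θ) (hθ1 : θ < 1)
    (hβ1' : ∀ w, |w| ≤ (1 - θ) * δ / 2 → β w = 1)
    (hβ0 : ∀ w, β w ≠ 0 → |w| < (1 - θ / 2) * δ / 2) (hβp : ∀ w, 0 ≤ β w) (hβ1 : ∀ w, β w ≤ 1)
    (x : ℂ) :
    ∫ y, gaussWeight ℓ (y - x) ^ 2 * (1 - ∑' e : (zdGraph 2).edgeSet, hB[β, medialPoint δ e.1, y]) ^ 2 ≤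
      60 * θ * ℓ ^ 2 := by
  set P : Set ℂ := ⋃ e : (zdGraph 2).edgeSet, {y : ℂ | Dg[y - medialPoint δ e.1] ≤ (1 - θ) * δ / 2}
    with hP
  -- pointwise domination by the indicator of the complement of the plateaus
  have hdom : ∀ y, gaussWeight ℓ (y - x) ^ 2 *
      (1 - ∑' e : (zdGraph 2).edgeSet, hB[β, medialPoint δ e.1, y]) ^ 2 ≤
      Pᶜ.indicator (fun y => gaussWeight ℓ (y - x) ^ 2) y := by
    intro y
    by_cases hy : y ∈ P
    · rw [indicator_of_notMem (notMem_compl_iff.2 hy)]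
      obtain ⟨e₀, he₀⟩ := mem_iUnion.1 hy
      rw [tsum_hB_eq_one_of_plateau hδ hθ0 hβ1' hβ0 hβp hβ1 he₀]
      simp
    · rw [indicator_of_mem (mem_compl hy)]
      obtain ⟨h0, h1⟩ := tsum_hB_le_one hδ hθ0 hβ0 hβp hβ1 y
      have : (1 - ∑' e : (zdGraph 2).edgeSet, hB[β, medialPoint δ e.1, y]) ^ 2 ≤ 1 := by nlinarith
      nlinarith [sq_nonneg (gaussWeight ℓ (y - x))]
  have hPmeas : MeasurableSet P :=
    MeasurableSet.iUnion fun e => (isClosed_ccell _ _).measurableSet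
  have hK2 : Integrable fun y : ℂ => gaussWeight ℓ (y - x) ^ 2 := by
    have := integrable_exp_neg_sq_norm_sub_div (c := ℓ ^ 2) (by positivity) x
    refine this.congr (Eventually.of_forall fun y => ?_)
    simp only [gaussWeight_sq]
  have hind : Integrable (Pᶜ.indicator fun y => gaussWeight ℓ (y - x) ^ 2) :=
    hK2.indicator hPmeas.compl
  calc ∫ y, gaussWeight ℓ (y - x) ^ 2 *
        (1 - ∑' e : (zdGraph 2).edgeSet, hB[β, medialPoint δ e.1, y]) ^ 2
      ≤ ∫ y, Pᶜ.indicator (fun y => gaussWeight ℓ (y - x) ^ 2) y :=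
        integral_mono_of_nonneg (Eventually.of_forall fun y => by positivity) hind
          (Eventually.of_forall hdom)
    _ = ∫ y in Pᶜ, gaussWeight ℓ (y - x) ^ 2 := integral_indicator hPmeas.compl
    _ = (∫⁻ y in Pᶜ, ENNReal.ofReal (gaussWeight ℓ (y - x) ^ 2)).toReal :=
        integral_eq_lintegral_of_nonneg_ae (Eventually.of_forall fun y => sq_nonneg _)
          hK2.aestronglyMeasurable.restrict
    _ ≤ (ENNReal.ofReal (60 * θ * ℓ ^ 2)).toReal := by
        refine ENNReal.toReal_mono ENNReal.ofReal_ne_top ?_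
        rw [hP]
        exact lintegral_gaussWeight_sq_offPlateau_le hℓ hδ hδℓ hθ0 hθ1 x
    _ = 60 * θ * ℓ ^ 2 := ENNReal.toReal_ofReal (by positivity)

/-- **The variance bound along an exhaustion**: for every `ε > 0`, eventually
`∫ φ_{s_n}² ≤ 26 δ² + 120 θ ℓ² + ε`. -/
theorem integral_sq_partial_le_eventually (hℓ : 0 < ℓ) (hδ : 0 < δ) (hδℓ : δ ≤ ℓ) (hθ0 : 0 < θ)
    (hθ1 : θ < 1) (hβ : ContDiff ℝ ∞ β) (hβ1' : ∀ w, |w| ≤ (1 - θ) * δ / 2 → β w = 1)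
    (hβ0 : ∀ w, β w ≠ 0 → |w| < (1 - θ / 2) * δ / 2) (hβp : ∀ w, 0 ≤ β w) (hβ1 : ∀ w, β w ≤ 1)
    (x : ℂ) {s : ℕ → Finset (zdGraph 2).edgeSet} (hmono : Monotone s) (hex : ∀ e, ∃ n, e ∈ s n)
    {ε : ℝ} (hε : 0 < ε) :
    ∀ᶠ n in atTop, ∫ y, (∑ e ∈ s n, gaussWeight ℓ (x - medialPoint δ e.1) * hB[β, medialPoint δ e.1, y] -
        gaussWeight ℓ (y - x)) ^ 2 ≤ 26 * δ ^ 2 + 120 * θ * ℓ ^ 2 + ε := by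
  have ht := tendsto_integral_margin hℓ hδ hθ0 hβ hβ0 hβp hβ1 x hmono hex
  have hlim := integral_margin_limit_le hℓ hδ hδℓ hθ0 hθ1 hβ1' hβ0 hβp hβ1 x
  have hev : ∀ᶠ n in atTop, ∫ y, gaussWeight ℓ (y - x) ^ 2 *
      (1 - ∑ e ∈ s n, hB[β, medialPoint δ e.1, y]) ^ 2 < 60 * θ * ℓ ^ 2 + ε / 2 :=
    ht (Iio_mem_nhds (by linarith))
  filter_upwards [hev] with n hn
  have := integral_sq_partial_le hℓ hδ hδℓ hθ0 hβ hβ0 hβp hβ1 (s n) x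
  linarith

end

end WhiteToColoured

end Summit.CriticalPhenomena.CardyFormulaZ2.Theorems
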